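import Summits.ValiantsHypothesis.ValiantsHypothesis.Theses.UlrichPadded
import Literature.Computability.AlgebraicComplexity.PermanentIrreducible
import Literature.AlgebraicGeometry.Resolution.RegularLocalRingsJacobian
import Literature.LinearAlgebra.Matrix.PermanentSubperm

/-!
# `PermHypersurfaceFactorial` — negative lemmas: the load-bearing hypotheses of the stubs of line
`derivation-symbolic-square` (crux stmt-ValiantsHypothesis-5666, route `UlrichPadded`)

Refuter's mutation analysis (drefute, 2026-08-16) of the four registered stubs of
`Cruxes/PermHypersurfaceFactorial/Lines/derivation-symbolic-square.lean`.  Each main theorem below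
is a registered stub with ONE hypothesis dropped or weakened, NEGATED, and killed by an explicit
small model (statements inline, witnesses written out in full; no definitions, no notation).
Self-contained: Theses + Literature imports only.

* `stub2_false_without_notMem`, `stub2_false_with_ne_zero` — `stub_regular_of_pderiv_notMem`:
  the hypothesis `∂f/∂x_i ∉ 𝔮` can be neither dropped nor weakened to `∂f/∂x_i ≠ 0`; witness
  `K = ℚ`, `σ = Fin 1`, `f = x²`, `P = (x̄)`: `(ℚ[x]/(x²))_(x̄)` is not regular (tree Jacobian
  criterion `not_isRegularLocalRing_localization_of_pderiv_eval_eq_zero`, Hartshorne I 5.1).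
* `stub4_false_without_guard` — `stub_gradedDescent`: the guard cannot be dropped; at `n = 0`,
  `per_0 = 1`, `S_0 = 0` has no maximal ideals (hypothesis vacuous) and is not a domain
  (`1 ≤ n` suffices on paper: `S_1 ≅ ℂ`; at `n = 2` the hypothesis fails at the vertex).
* `stub1_false_with_two_le` — `stub_missingPartial`: the guard `3 ≤ n` cannot be weakened to
  `2 ≤ n`; at `n = 2` the vertex `M = (x̄) ⊂ S_2` is a prime of height `≤ 3` (Krull's height
  theorem: `M` is minimal over `(x̄₀₀ + x̄₁₁, x̄₀₁, x̄₁₀)`) whose preimage `(x)` contains all four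
  partials `∂per_2/∂x_ij = x_{1-i,1-j}`.
* `regularCodimThree_two_false` — the hypothesis `hreg` of `stub_localFactorial` (regular in
  codimension `≤ 3`, the line's `RegularCodimThree n`) is FALSE at `n = 2` (the vertex is a
  singular prime of height `≤ 3`), so stub 3 is vacuous at `n = 2` and its own guard is decoration,
  while `RegularCodimThree n` genuinely needs `3 ≤ n` — consistent with the standing disprover's
  `factorialAt_two_false` / `permHypersurfaceFactorial_false_without_three_le`.
[folklore]
-/

noncomputable section

open MvPolynomial IsLocalRing Literature.Computability.AlgebraicComplexity

namespace Summit.ValiantsHypothesis.ValiantsHypothesis.Theorems.PermHypersurfaceFactorial.Negative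

/-! ## Stub 2 without / with weakened non-membership hypothesis

Witness: `x²` in `ℚ[x]` (`σ = Fin 1`) and the vertex `P = (x̄) = (ker eval₀)/(x²)` of `ℚ[x]/(x²)`;
in §3 the vertex `M = (x̄) = (x)/(per_2)` of `S_2 = ℂ[x_{2×2}]/(per_2)`. -/

/-- `x² ≠ 0`. [folklore] -/
theorem X_sq_ne_zero : (X 0 ^ 2 : MvPolynomial (Fin 1) ℚ) ≠ 0 := pow_ne_zero _ (X_ne_zero _)

/-- `x²` vanishes at the origin. [folklore] -/
theorem eval_X_sq : eval (0 : Fin 1 → ℚ) (X 0 ^ 2 : MvPolynomial (Fin 1) ℚ) = 0 := by simp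

/-- `∂(x²)/∂x = 2x`. [folklore] -/
theorem pderiv_X_sq (i : Fin 1) : pderiv i (X 0 ^ 2 : MvPolynomial (Fin 1) ℚ) = 2 * X 0 := by
  have hi : i = 0 := Subsingleton.elim _ _
  subst hi
  rw [sq, Derivation.leibniz, pderiv_X, two_mul]
  simp

/-- The gradient of `x²` vanishes at the origin. [folklore] -/
theorem eval_pderiv_X_sq (i : Fin 1) :
    eval (0 : Fin 1 → ℚ) (pderiv i (X 0 ^ 2 : MvPolynomial (Fin 1) ℚ)) = 0 := by
  rw [pderiv_X_sq]; simp

/-- `∂(x²)/∂x ≠ 0` over `ℚ`. [folklore] -/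
theorem pderiv_X_sq_ne_zero : pderiv (0 : Fin 1) (X 0 ^ 2 : MvPolynomial (Fin 1) ℚ) ≠ 0 := by
  intro h
  have h1 :
      eval (fun _ => (1 : ℚ)) (pderiv (0 : Fin 1) (X 0 ^ 2 : MvPolynomial (Fin 1) ℚ)) = 2 := by
    rw [pderiv_X_sq]; simp
  rw [h, map_zero] at h1
  norm_num at h1

/-- `(x²) ⊆ ker eval₀`. [folklore] -/
theorem ker_mk_le :
    RingHom.ker (Ideal.Quotient.mk (Ideal.span {(X 0 ^ 2 : MvPolynomial (Fin 1) ℚ)})) ≤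
      RingHom.ker (eval (0 : Fin 1 → ℚ)) := by
  rw [Ideal.mk_ker, Ideal.span_le, Set.singleton_subset_iff]
  exact eval_X_sq

/-- The vertex `(x̄) = (ker eval₀)/(x²)` of `ℚ[x]/(x²)` is a prime ideal. [folklore] -/
theorem vertexSq_isPrime :
    (Ideal.map (Ideal.Quotient.mk (Ideal.span {(X 0 ^ 2 : MvPolynomial (Fin 1) ℚ)}))
      (RingHom.ker (eval (0 : Fin 1 → ℚ)))).IsPrime :=
  haveI := RingHom.ker_isPrime (eval (0 : Fin 1 → ℚ))
  Ideal.map_isPrime_of_surjective Ideal.Quotient.mk_surjective ker_mk_le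

/-- The preimage of the vertex is `ker eval₀ = (x)`. [folklore] -/
theorem comap_vertexSq :
    (Ideal.map (Ideal.Quotient.mk (Ideal.span {(X 0 ^ 2 : MvPolynomial (Fin 1) ℚ)}))
        (RingHom.ker (eval (0 : Fin 1 → ℚ)))).comap
          (Ideal.Quotient.mk (Ideal.span {(X 0 ^ 2 : MvPolynomial (Fin 1) ℚ)})) =
      RingHom.ker (eval (0 : Fin 1 → ℚ)) := by
  rw [Ideal.comap_map_of_surjective _ Ideal.Quotient.mk_surjective, sup_eq_left]
  exact le_trans (fun x hx => hx) ker_mk_le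

/-- The vertex of `ℚ[x]/(x²)` is not a regular point (tree Jacobian criterion, singular direction).
[folklore] -/
theorem not_isRegularLocalRing_vertexSq :
    haveI := vertexSq_isPrime
    ¬ IsRegularLocalRing (Localization.AtPrime
      (Ideal.map (Ideal.Quotient.mk (Ideal.span {(X 0 ^ 2 : MvPolynomial (Fin 1) ℚ)}))
        (RingHom.ker (eval (0 : Fin 1 → ℚ))))) :=
  haveI := vertexSq_isPrime
  Literature.AlgebraicGeometry.Resolution.not_isRegularLocalRing_localization_of_pderiv_eval_eq_zero
    (0 : Fin 1 → ℚ) X_sq_ne_zero eval_X_sq eval_pderiv_X_sq _ comap_vertexSq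

/-- **Any proof of stub 2 must use `∂f/∂x_i ∉ 𝔮`:** `stub_regular_of_pderiv_notMem` with that
hypothesis DROPPED is false. [folklore] -/
theorem stub2_false_without_notMem :
    ¬ (∀ (σ K : Type) [Finite σ] [Field K] (f : MvPolynomial σ K)
        (P : Ideal (MvPolynomial σ K ⧸ Ideal.span {f})) [P.IsPrime],
        IsRegularLocalRing (Localization.AtPrime P)) := by
  intro h
  haveI := vertexSq_isPrime
  exact not_isRegularLocalRing_vertexSq (h (Fin 1) ℚ _ _)

/-- **… and `∂f/∂x_i ≠ 0` is not enough:** `stub_regular_of_pderiv_notMem` with `∂f/∂x_i ∉ 𝔮`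
WEAKENED to `∂f/∂x_i ≠ 0` is false (`∂(x²)/∂x = 2x ≠ 0` lies in `𝔮 = (x)`). [folklore] -/
theorem stub2_false_with_ne_zero :
    ¬ (∀ (σ K : Type) [Finite σ] [Field K] (f : MvPolynomial σ K) (i : σ)
        (P : Ideal (MvPolynomial σ K ⧸ Ideal.span {f})) [P.IsPrime],
        pderiv i f ≠ 0 → IsRegularLocalRing (Localization.AtPrime P)) := by
  intro h
  haveI := vertexSq_isPrime
  exact not_isRegularLocalRing_vertexSq (h (Fin 1) ℚ _ 0 _ pderiv_X_sq_ne_zero)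

/-! ## Stub 4 without the guard: false at `n = 0` -/

/-- `per_0 = 1` (the empty permanent). [folklore] -/
theorem perPoly_fin_zero : perPoly (Fin 0) ℂ = 1 := by
  simp [perPoly, Matrix.permanent_isEmpty]

/-- `S_0 = ℂ[∅]/(1)` is the zero ring. [folklore] -/
theorem subsingleton_S_zero :
    Subsingleton (MvPolynomial (Fin 0 × Fin 0) ℂ ⧸ Ideal.span {perPoly (Fin 0) ℂ}) := by
  rw [Ideal.Quotient.subsingleton_iff, perPoly_fin_zero, Ideal.span_singleton_one]

/-- **Any proof of stub 4 must use the guard (at least `1 ≤ n`):** `stub_gradedDescent` with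
`3 ≤ n` DROPPED is false — at `n = 0` the hypothesis is vacuous (no maximal ideals in the zero
ring) and the conclusion `IsDomain S_0` fails. [folklore] -/
theorem stub4_false_without_guard :
    ¬ (∀ n : ℕ,
        (∀ (M : Ideal (MvPolynomial (Fin n × Fin n) ℂ ⧸ Ideal.span {perPoly (Fin n) ℂ}))
            [M.IsMaximal],
            ∃ _ : IsDomain (Localization.AtPrime M),
              UniqueFactorizationMonoid (Localization.AtPrime M)) →
          ∃ _ : IsDomain (MvPolynomial (Fin n × Fin n) ℂ ⧸ Ideal.span {perPoly (Fin n) ℂ}),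
            UniqueFactorizationMonoid
              (MvPolynomial (Fin n × Fin n) ℂ ⧸ Ideal.span {perPoly (Fin n) ℂ})) := by
  intro h
  haveI := subsingleton_S_zero
  obtain ⟨hdom, -⟩ := h 0 (fun M hM => absurd (Subsingleton.elim M ⊤) hM.ne_top)
  haveI := hdom
  exact false_of_nontrivial_of_subsingleton
    (MvPolynomial (Fin 0 × Fin 0) ℂ ⧸ Ideal.span {perPoly (Fin 0) ℂ})

/-! ## Stub 1 with the guard weakened to `2 ≤ n`: false at `n = 2` (the vertex of the cone)

Upstairs `𝔪 = (x_p : p) = idealOfVars ⊂ ℂ[x_{2×2}]`; the vertex of `S_2 = ℂ[x]/(per_2)` is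
`M = 𝔪/(per_2) = Ideal.map (Ideal.Quotient.mk (per_2)) 𝔪`. -/

/-- `per_2 = x₀₀x₁₁ + x₀₁x₁₀`. [folklore] -/
theorem perPoly_fin_two : perPoly (Fin 2) ℂ = X (0, 0) * X (1, 1) + X (0, 1) * X (1, 0) := by
  simp [perPoly, Matrix.permanent_fin_two_row, Matrix.mvPolynomialX]

/-- Every variable lies in `𝔪`. [folklore] -/
theorem X_mem_idealOfVars_two (p : Fin 2 × Fin 2) :
    (X p : MvPolynomial (Fin 2 × Fin 2) ℂ) ∈ idealOfVars (Fin 2 × Fin 2) ℂ :=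
  Ideal.subset_span ⟨p, rfl⟩

/-- A polynomial with vanishing constant term lies in the ideal of the variables. [folklore] -/
theorem mem_idealOfVars_of_constantCoeff_eq_zero {σ : Type*} {p : MvPolynomial σ ℂ}
    (hp : constantCoeff p = 0) : p ∈ idealOfVars σ ℂ := by
  rw [← pow_one (idealOfVars σ ℂ), mem_pow_idealOfVars_iff']
  intro x hx
  have hx0 : x = 0 := by
    have h : Finsupp.degree x = 0 := Nat.lt_one_iff.mp hx
    exact (Finsupp.degree_eq_zero_iff x).mp h
  subst hx0
  exact hp

/-- `𝔪 = ker (constant coefficient)`. [folklore] -/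
theorem idealOfVars_two_eq_ker : idealOfVars (Fin 2 × Fin 2) ℂ =
    RingHom.ker (constantCoeff : MvPolynomial (Fin 2 × Fin 2) ℂ →+* ℂ) := by
  apply le_antisymm
  · rw [Ideal.span_le]
    rintro _ ⟨p, rfl⟩
    simp [RingHom.mem_ker]
  · intro f hf
    exact mem_idealOfVars_of_constantCoeff_eq_zero ((RingHom.mem_ker).mp hf)

/-- `𝔪` is prime. [folklore] -/
theorem idealOfVars_two_isPrime : (idealOfVars (Fin 2 × Fin 2) ℂ).IsPrime := by
  rw [idealOfVars_two_eq_ker]; exact RingHom.ker_isPrime _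

/-- `per_2 ∈ 𝔪`. [folklore] -/
theorem perPoly_mem_idealOfVars_two : perPoly (Fin 2) ℂ ∈ idealOfVars (Fin 2 × Fin 2) ℂ := by
  rw [perPoly_fin_two]
  exact add_mem (Ideal.mul_mem_left _ _ (X_mem_idealOfVars_two _))
    (Ideal.mul_mem_left _ _ (X_mem_idealOfVars_two _))

/-- All four partials `∂per_2/∂x_ij` are variables, hence in `𝔪`. [folklore] -/
theorem pderiv_perPoly_two_mem (ij : Fin 2 × Fin 2) :
    pderiv ij (perPoly (Fin 2) ℂ) ∈ idealOfVars (Fin 2 × Fin 2) ℂ := by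
  rw [perPoly_fin_two]
  obtain ⟨i, j⟩ := ij
  fin_cases i <;> fin_cases j <;>
    simp [Derivation.leibniz, pderiv_X, smul_eq_mul] <;>
    exact X_mem_idealOfVars_two _

/-- `(per_2) ⊆ 𝔪`. [folklore] -/
theorem ker_mk_le_idealOfVars_two :
    RingHom.ker (Ideal.Quotient.mk (Ideal.span {perPoly (Fin 2) ℂ})) ≤
      idealOfVars (Fin 2 × Fin 2) ℂ := by
  rw [Ideal.mk_ker, Ideal.span_le, Set.singleton_subset_iff]
  exact perPoly_mem_idealOfVars_two

/-- The vertex `M` is prime. [folklore] -/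
theorem vertex_isPrime :
    (Ideal.map (Ideal.Quotient.mk (Ideal.span {perPoly (Fin 2) ℂ}))
      (idealOfVars (Fin 2 × Fin 2) ℂ)).IsPrime :=
  haveI := idealOfVars_two_isPrime
  Ideal.map_isPrime_of_surjective Ideal.Quotient.mk_surjective ker_mk_le_idealOfVars_two

/-- **Krull's height theorem at the vertex: `height M ≤ 3`**, because `M` is a minimal prime of
the `3`-generated ideal `(x̄₀₀ + x̄₁₁, x̄₀₁, x̄₁₀)` of `S_2` (a prime containing these contains
`x̄₀₀² = x̄₀₀(x̄₀₀ + x̄₁₁) + x̄₀₁x̄₁₀`, hence every `x̄_p`). [folklore] -/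
theorem height_vertex_le :
    (Ideal.map (Ideal.Quotient.mk (Ideal.span {perPoly (Fin 2) ℂ}))
      (idealOfVars (Fin 2 × Fin 2) ℂ)).height ≤ 3 := by
  set mk : MvPolynomial (Fin 2 × Fin 2) ℂ →+*
      MvPolynomial (Fin 2 × Fin 2) ℂ ⧸ Ideal.span {perPoly (Fin 2) ℂ} :=
    Ideal.Quotient.mk (Ideal.span {perPoly (Fin 2) ℂ}) with hmk
  -- the relation `x̄₀₁ x̄₁₀ = -x̄₀₀ x̄₁₁`
  have hrel : mk (X (0, 1)) * mk (X (1, 0)) = -(mk (X (0, 0)) * mk (X (1, 1))) := by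
    rw [← map_mul, ← map_mul, ← map_neg, hmk, Ideal.Quotient.eq, Ideal.mem_span_singleton']
    exact ⟨1, by rw [perPoly_fin_two]; ring⟩
  -- the three generators
  set s : Set (MvPolynomial (Fin 2 × Fin 2) ℂ ⧸ Ideal.span {perPoly (Fin 2) ℂ}) :=
    {mk (X (0, 0)) + mk (X (1, 1)), mk (X (0, 1)), mk (X (1, 0))} with hs
  have hcard : s.ncard ≤ 3 :=
    (Set.ncard_insert_le _ _).trans
      (Nat.succ_le_succ ((Set.ncard_insert_le _ _).trans (by rw [Set.ncard_singleton])))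
  -- a prime over the generators contains every `x̄_p`
  have hgen : ∀ q : Ideal (MvPolynomial (Fin 2 × Fin 2) ℂ ⧸ Ideal.span {perPoly (Fin 2) ℂ}),
      q.IsPrime → Ideal.span s ≤ q → ∀ p, mk (X p) ∈ q := by
    intro q hq hJ p
    have ha : mk (X (0, 0)) + mk (X (1, 1)) ∈ q := hJ (Ideal.subset_span (by simp [hs]))
    have h01 : mk (X (0, 1)) ∈ q := hJ (Ideal.subset_span (by simp [hs]))
    have h10 : mk (X (1, 0)) ∈ q := hJ (Ideal.subset_span (by simp [hs]))
    have hprod : mk (X (0, 0)) * mk (X (1, 1)) ∈ q := by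
      have := q.mul_mem_right (mk (X (1, 0))) h01
      rw [hrel] at this
      exact q.neg_mem_iff.mp this
    have h00 : mk (X (0, 0)) ∈ q := by
      have hsq : mk (X (0, 0)) * mk (X (0, 0)) ∈ q := by
        have h1 : mk (X (0, 0)) * (mk (X (0, 0)) + mk (X (1, 1))) ∈ q := q.mul_mem_left _ ha
        have h2 : mk (X (0, 0)) * mk (X (0, 0)) =
            mk (X (0, 0)) * (mk (X (0, 0)) + mk (X (1, 1))) - mk (X (0, 0)) * mk (X (1, 1)) := by
          ring
        rw [h2]
        exact q.sub_mem h1 hprod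
      exact (hq.mem_or_mem hsq).elim id id
    have h11 : mk (X (1, 1)) ∈ q := by
      have : mk (X (1, 1)) = (mk (X (0, 0)) + mk (X (1, 1))) - mk (X (0, 0)) := by ring
      rw [this]
      exact q.sub_mem ha h00
    obtain ⟨i, j⟩ := p
    fin_cases i <;> fin_cases j
    · exact h00
    · exact h01
    · exact h10
    · exact h11
  -- `M` is a minimal prime of `span s`
  have hmin : Ideal.map mk (idealOfVars (Fin 2 × Fin 2) ℂ) ∈ (Ideal.span s).minimalPrimes := by
    refine ⟨⟨vertex_isPrime, ?_⟩, ?_⟩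
    · rw [Ideal.span_le]
      intro g hg
      simp only [hs, Set.mem_insert_iff, Set.mem_singleton_iff] at hg
      rcases hg with rfl | rfl | rfl
      · exact add_mem (Ideal.mem_map_of_mem _ (X_mem_idealOfVars_two _))
          (Ideal.mem_map_of_mem _ (X_mem_idealOfVars_two _))
      · exact Ideal.mem_map_of_mem _ (X_mem_idealOfVars_two _)
      · exact Ideal.mem_map_of_mem _ (X_mem_idealOfVars_two _)
    · rintro q ⟨hq, hJq⟩ _
      change Ideal.map mk (idealOfVars (Fin 2 × Fin 2) ℂ) ≤ q
      rw [Ideal.map_le_iff_le_comap, Ideal.span_le]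
      rintro _ ⟨p, rfl⟩
      exact hgen q hq hJq p
  exact (Ideal.height_le_card_of_mem_minimalPrimes_span (Set.toFinite _) hmin).trans
    (by exact_mod_cast hcard)

/-- Every partial of `per_2` lies in the preimage of the vertex. [folklore] -/
theorem pderiv_mem_comap_vertex (ij : Fin 2 × Fin 2) :
    pderiv ij (perPoly (Fin 2) ℂ) ∈
      (Ideal.map (Ideal.Quotient.mk (Ideal.span {perPoly (Fin 2) ℂ}))
        (idealOfVars (Fin 2 × Fin 2) ℂ)).comap
          (Ideal.Quotient.mk (Ideal.span {perPoly (Fin 2) ℂ})) :=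
  Ideal.le_comap_map (pderiv_perPoly_two_mem ij)

/-- **Any proof of stub 1 must use `3 ≤ n` (it must fail at `n = 2`):** `stub_missingPartial` with
the guard weakened to `2 ≤ n` is false — the vertex of the quadric cone `S_2` is a prime of height
`≤ 3` whose preimage contains `per_2` and all its partials. [folklore] -/
theorem stub1_false_with_two_le :
    ¬ (∀ n : ℕ, 2 ≤ n →
        ∀ (P : Ideal (MvPolynomial (Fin n × Fin n) ℂ ⧸ Ideal.span {perPoly (Fin n) ℂ})) [P.IsPrime],
          P.height ≤ 3 →
            ∃ ij : Fin n × Fin n, pderiv ij (perPoly (Fin n) ℂ) ∉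
              P.comap (Ideal.Quotient.mk (Ideal.span {perPoly (Fin n) ℂ}))) := by
  intro h
  haveI := vertex_isPrime
  obtain ⟨ij, hij⟩ := h 2 le_rfl _ height_vertex_le
  exact hij (pderiv_mem_comap_vertex ij)

/-! ## Stub 3: its hypothesis `hreg` (regular in codimension ≤ 3) is FALSE at `n = 2`

So `stub_localFactorial` holds vacuously at `n = 2` and trivially at `n = 0, 1`: its guard `3 ≤ n`
is decoration (information for the prover), while the line's intermediate `RegularCodimThree n`
genuinely needs `3 ≤ n` — the vertex again (tree Jacobian criterion at `a = 0`: `per_2(0) = 0`,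
`∇per_2(0) = 0`). -/

/-- `per_2(0) = 0`. [folklore] -/
theorem eval_zero_perPoly_two : eval (0 : Fin 2 × Fin 2 → ℂ) (perPoly (Fin 2) ℂ) = 0 := by
  rw [perPoly_fin_two]; simp

/-- `∇per_2(0) = 0`. [folklore] -/
theorem eval_zero_pderiv_perPoly_two (ij : Fin 2 × Fin 2) :
    eval (0 : Fin 2 × Fin 2 → ℂ) (pderiv ij (perPoly (Fin 2) ℂ)) = 0 := by
  have h := pderiv_perPoly_two_mem ij
  rw [idealOfVars_two_eq_ker, RingHom.mem_ker] at h
  rw [MvPolynomial.eval_zero]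
  exact h

/-- `per_2 ≠ 0`. [folklore] -/
theorem perPoly_two_ne_zero : perPoly (Fin 2) ℂ ≠ 0 := (perPoly_irreducible (n := Fin 2)).ne_zero

/-- The preimage of the vertex is `ker eval₀`. [folklore] -/
theorem comap_vertex :
    (Ideal.map (Ideal.Quotient.mk (Ideal.span {perPoly (Fin 2) ℂ}))
        (idealOfVars (Fin 2 × Fin 2) ℂ)).comap
          (Ideal.Quotient.mk (Ideal.span {perPoly (Fin 2) ℂ})) =
      RingHom.ker (eval (0 : Fin 2 × Fin 2 → ℂ)) := by
  rw [Ideal.comap_map_of_surjective _ Ideal.Quotient.mk_surjective, sup_eq_left.mpr,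
    idealOfVars_two_eq_ker, MvPolynomial.eval_zero]
  exact le_trans (fun x hx => hx) ker_mk_le_idealOfVars_two

/-- The line's `hreg` / `RegularCodimThree` at `n = 2` is false: the vertex `M ⊂ S_2` has height
`≤ 3` and `(S_2)_M` is not a regular local ring. [folklore] -/
theorem regularCodimThree_two_false :
    ¬ (∀ (Q : Ideal (MvPolynomial (Fin 2 × Fin 2) ℂ ⧸ Ideal.span {perPoly (Fin 2) ℂ})) [Q.IsPrime],
        Q.height ≤ 3 → IsRegularLocalRing (Localization.AtPrime Q)) := by
  intro h
  haveI := vertex_isPrime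
  exact
    Literature.AlgebraicGeometry.Resolution.not_isRegularLocalRing_localization_of_pderiv_eval_eq_zero
      (0 : Fin 2 × Fin 2 → ℂ) perPoly_two_ne_zero eval_zero_perPoly_two eval_zero_pderiv_perPoly_two
      _ comap_vertex (h _ height_vertex_le)

end Summit.ValiantsHypothesis.ValiantsHypothesis.Theorems.PermHypersurfaceFactorial.Negative

end
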